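import Summits.BirchSwinnertonDyer.Rank1Residual.X5.KummerRelaxedStrictCount
import HarnessLib

/-!
# Route `GenusKolyvaginAtTwo`, crux #2 `GenusPrimitiveSupplyAtTwo` (stmt-BirchSwinnertonDyer-22136):
# the one-place Poitou–Tate count AT AN ARBITRARY PLACE — in particular at a REAL place — and the archimedean
# Kummer count `[Sel^{(n)} relaxed at w : Sel^{(n)} strict at w] = #𝓛_w` (the «Howard count at ∞» the
# Δ > 0 rows of the supply ask for)

Width seat `bsd-line-gk2-p5` g9 (cell `bsd-f1-sign2`, SUPPLY lineage, «UP general-K lane»), file 17 of the series (crux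
workfile `Lines/genus-supply-mr-instantiation.md` §3 / §5: «T-A / T-V: the T-place is ARCHIMEDEAN; X11b's PT count is typed at
finite places (`Sum.inr w₀`)»; gk2-p4 g9 FINAL: «NOT done: T-A/T-V = Cor 3.4 (i) at the REAL place (needs Howard count at ∞)»).
THEOREMS ONLY (no definition, no named fact, no `sorry`); helper `--supports stmt-BirchSwinnertonDyer-22136`; no item is closed;
BSD is not proved by any of this.

WHAT. X11b's counting form of Poitou–Tate duality (`X11b.PoitouTateCounting.relIndex_selmerGroup_mul_relIndex_dual_eq`,
Howard 2004 Thm. 2.1.11 / JSW17 Prop. 3.2.1: `[H¹_𝓖 : H¹_𝓕]·[H¹_{𝓕^*} : H¹_{𝓖^*}] = [𝓖_{v₀} : 𝓕_{v₀}]` for structures differing at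
ONE place `v₀`) and its self-dual specialisation (X5 `SelfDualCount.relIndex_update_bot_update_top_sq_eq_natCard`,
`…KummerRelaxedStrictCount.relIndex_kummer_update_bot_update_top_eq`) are typed at a FINITE place `v₀ = Sum.inr w₀`, where the
local perfectness comes from the family's `IsPerfect` clause. The proofs use the place only through (i) the finiteness of
`H¹(K_{v₀}, M)`, `H¹(K_{v₀}, M^D)` and (ii) the bijectivity of both adjoints of `⟨·,·⟩_{v₀} = inv_{v₀}(· ∪ ·)`. This file:

* §41 `sup_map_selmerGroup_eq_annLeft_of_bijective`, `relIndex_selmerGroup_mul_relIndex_dual_eq_of_bijective` — the SAME two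
  theorems at an ARBITRARY place `v₀ : Place K`, with (i) and (ii) as hypotheses (proofs verbatim from X11b);
  `dualLocalCondition_top_of_injective` (`(H¹)^* = 0` from injectivity of the right adjoint).
* §42 `bijective_localTatePairingZMod_inl` — for `M = E[n]` at an INFINITE place `w` with `inv_w` injective (the real-place clause
  of `poitouTate_selmerStructure_duality_real`), (ii) holds: archimedean Tate duality for `E[n]` (tree
  `bijective_weilCupProduct_infinitePlace`, Milne I Thm. 2.13) transported from the Weil self-pairing to the `M^D`-pairing along
  `H¹(w_v)` (tree `X11b.LocBridge.localTatePairingZMod_map_weilDual`, `map_weilDual_map_weilDualInv_restrictField`).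
* (sequel `…ArchimedeanKummerCount.lean`, §43) `dualTransported_update_top_inl`, `relIndex_update_bot_update_top_sq_eq_natCard_inl` —
  X5 §2–§3 at an infinite place: `[H¹_{𝓛^{w}} : H¹_{𝓛_{w}}]² = #H¹(K_w, E[n])` for `𝓛` residually self-dual away from `w`.
* (sequel, §44) **`relIndex_kummer_update_bot_update_top_inl_eq`**, `relIndex_kummerStrict_kummerRelaxed_singleton_inl_eq[_of_facts]` —
  THE ARCHIMEDEAN KUMMER COUNT: for `n = p^k` and an infinite place `w`,
  `[Sel^{(n)} relaxed at w : Sel^{(n)} strict at w] = #𝓛_w` (`𝓛_w = kummerSelmerStructure n (Sum.inl w)` = the image of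
  `E(K_w)/n`; so `= [E(K_w) : nE(K_w)]`, tree `natCard_kummerLocalConditionAt_eq_index`), GIVEN the facts
  `poitouTate_selmerStructure_duality_real K` (Milne I 4.10 + Ex. 1.6 (c)) and `localEulerPoincareCharacteristic K_v` (Tate, for the
  self-duality of the Kummer structure at the FINITE places). For `K = ℚ`, `n = 2`: the index is `#E(ℝ)/2E(ℝ)`, i.e. `2` if `Δ > 0`
  and `1` if `Δ < 0` (Kramer 1981 Prop. 6, tree `Kramer1981.index_range_two_eq_two_of_Δ_pos` / `range_two_eq_top_of_Δ_neg` over `ℝ`).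

With §44 (sequel) the UP / DOWN transfer of Mazur–Rubin Cor. 3.4 (i) at `T = {∞}` (the cell's T-A `AdmissibleTwistSelmerShiftAtTwo`, T-V,
-desc's T-C `EggTwistLawAtTwo`) reduces, exactly as at a finite twisting prime (p620256 DOWN / p628794 UP), to the transversality of
the two Kummer lines at the real place (Kramer Prop. 6 / MR Lemma 2.9 at `v = ∞`: `H¹_f(E) ∩ H¹_f(E^F) = N E(ℂ)/2E(ℝ) = 0` for
`Δ > 0`, `F` complex) — NOT done here. References: [Howard2004HeegnerKolyvagin] Thm. 2.1.11; [MilneADT2006] I Ex. 1.6 (c),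
Thm. 2.13, Rem. 3.7, Thm. 4.10, Lemma 6.15; [JetchevSkinnerWan2017] Prop. 3.2.1; [Sakamoto2024] §3.1.2; [Kramer1981] Prop. 6;
[MazurRubin2010] Lemma 2.9, Prop. 3.3.
-/

set_option linter.dupNamespace false -- tree convention: `Summit.BirchSwinnertonDyer.BirchSwinnertonDyer.Theorems` (summit = sub-problem)
set_option autoImplicit false

noncomputable section

open scoped Classical ContRepresentation

open CategoryTheory Field Function NumberField IsDedekindDomain WeierstrassCurve
open Literature.NumberTheory.EllipticCurves
open Literature.NumberTheory.GaloisRepresentations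
open Literature.NumberTheory.GaloisRepresentations.DiscreteGaloisModule (mu MuCarrier SelmerStructure
  localTatePairingZMod tateDual localMap)
open Literature.NumberTheory.GaloisCohomology
open Literature.NumberTheory.GaloisCohomology.LocalInvariants
open Summit.BirchSwinnertonDyer.Rank1Residual
open Summit.BirchSwinnertonDyer.Rank1Residual.X11b.FiniteDuality
open Summit.BirchSwinnertonDyer.Rank1Residual.X11b.LocBridge
open Summit.BirchSwinnertonDyer.Rank1Residual.X11b.Levels
open Summit.BirchSwinnertonDyer.Rank1Residual.X11b.PoitouTateCounting (relIndex_selmerGroup_eq)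
open Summit.BirchSwinnertonDyer.Rank1Residual.X5.SelfDualCount

namespace Summit.BirchSwinnertonDyer.BirchSwinnertonDyer.Theorems.GenusKolyArch

/-! ## §41 Howard's count at ONE ARBITRARY place, local finiteness and perfectness as hypotheses -/

section AnyPlace

variable {K : Type} [Field K] [NumberField K] {n : ℕ} {M : Type} [AddCommGroup M]
  [TopologicalSpace M] [DiscreteTopology M] [Finite M]
  {inv : LocalInvariants K n} {ρ : DiscreteGaloisModule K M}
  {S : Finset (Place K)} {𝓕 𝓖 : SelmerStructure ρ} {v₀ : Place K}

/-- **`(H¹(K_v, M))^* = 0` from the injectivity of the right adjoint of `⟨·,·⟩_v`** (X11b's `dualLocalCondition_top`, there at a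
finite place from `IsPerfect`; here at any place from the displayed injectivity).
[cite: Howard2004HeegnerKolyvagin, Def. 2.1.6 (arXiv:1202.6340 p. 5)] -/
theorem dualLocalCondition_top_of_injective
    (hinj : Injective (localTatePairingZMod ρ n v₀ (inv v₀)).flip) :
    inv.dualLocalCondition ρ v₀ ⊤ = ⊥ := by
  rw [eq_bot_iff]
  intro y hy
  rw [AddSubgroup.mem_bot]
  refine hinj (AddMonoidHom.ext fun a => ?_)
  rw [map_zero, AddMonoidHom.zero_apply, AddMonoidHom.flip_apply]
  exact hy a (AddSubgroup.mem_top a)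

/-- **Howard Thm. 2.1.11 at one ARBITRARY place `v₀ ∈ S` as an identity of subgroups of `H¹(K_{v₀}, M)`** — X11b's
`sup_map_selmerGroup_eq_annLeft` with the finiteness of `H¹(K_{v₀}, M)`, `H¹(K_{v₀}, M^D)` and the bijectivity of both adjoints of
`⟨·,·⟩_{v₀}` as HYPOTHESES (at a finite place they are Milne I 2.3 / the family's `IsPerfect`; at a real place Milne I 2.13, §42):
`loc_{v₀}(H¹_𝓖) + 𝓕_{v₀} = {}^⊥( loc_{v₀}(H¹_{𝓕^*}) + 𝓖^*_{v₀} )`. Proof verbatim from X11b (Poitou–Tate vanishing with `S = {v₀}`,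
double annihilator, `SelmerComplement` with `t` supported at `v₀`). [cite: Howard2004HeegnerKolyvagin, Thm. 2.1.11 (arXiv:1202.6340 p. 6)] -/
theorem sup_map_selmerGroup_eq_annLeft_of_bijective [NeZero n]
    [Finite (galoisCohomology (ρ.toLocal v₀) 1)] [Finite (galoisCohomology ((ρ.tateDual n).toLocal v₀) 1)]
    (hbij : Bijective (localTatePairingZMod ρ n v₀ (inv v₀)) ∧ Bijective (localTatePairingZMod ρ n v₀ (inv v₀)).flip)
    (hvan : inv.SumLocalTermEqZero) (hcomp : inv.SelmerComplement) (hM : ∀ m : M, n • m = 0)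
    (hS : ∀ v : HeightOneSpectrum (𝓞 K), (Sum.inr v : Place K) ∉ S →
      ((n : ℕ) : 𝓞 K) ∉ v.asIdeal ∧ GaloisRep.IsUnramifiedAt v ρ)
    (hle : 𝓕 ≤ 𝓖) (h𝓕 : 𝓕.IsUnramifiedOutside S) (h𝓖 : 𝓖.IsUnramifiedOutside S)
    (hw₀ : v₀ ∈ S) (heq : ∀ v ≠ v₀, 𝓕 v = 𝓖 v) :
    𝓖.selmerGroup.map (galoisCohomology.localization ρ v₀ 1) ⊔ 𝓕 v₀ =
      annLeft (localTatePairingZMod ρ n v₀ (inv v₀))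
        ((inv.dualSelmerStructure ρ 𝓕).selmerGroup.map
            (galoisCohomology.localization (ρ.tateDual n) v₀ 1) ⊔
          inv.dualSelmerStructure ρ 𝓖 v₀) := by
  classical
  set b := localTatePairingZMod ρ n v₀ (inv v₀) with hb
  have hA : ∀ a : galoisCohomology (ρ.toLocal v₀) 1, n • a = 0 :=
    galoisCohomology.nsmul_eq_zero_of_forall (ρ.toLocal v₀) hM
  have hB : ∀ y : galoisCohomology ((ρ.tateDual n).toLocal v₀) 1, n • y = 0 :=
    galoisCohomology.nsmul_eq_zero_of_forall _ fun f => DiscreteGaloisModule.TateDual.nsmul_eq_zero f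
  refine le_antisymm ?_ ?_
  · -- `⊆`: both summands pair to zero with both summands
    rw [annLeft_sup, le_inf_iff]
    refine ⟨sup_le ?_ ?_, sup_le ?_ ?_⟩
    · -- loc(Sel_𝓖) ⟂ loc(Sel_{𝓕^*}) : Poitou–Tate vanishing with `S = {v₀}`
      rintro _ ⟨x, hx, rfl⟩ _ ⟨y, hy, rfl⟩
      have hout : ∀ v ∉ ({v₀} : Finset (Place K)), 𝓖 v ≤ 𝓕 v := fun v hv =>
        (heq v (by simpa using hv)).symm.le
      have := hvan.sum_localTerm_selmer_eq_zero ρ hM (S := {v₀}) hout hx hy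
      rw [Finset.sum_singleton, localTerm_apply] at this
      simpa [hb] using this
    · -- 𝓕_{v₀} ⟂ loc(Sel_{𝓕^*}) : Selmer condition of `𝓕^*` at `v₀`
      rintro a ha _ ⟨y, hy, rfl⟩
      rw [SetLike.mem_coe, SelmerStructure.mem_selmerGroup_iff] at hy
      exact hy v₀ a ha
    · -- loc(Sel_𝓖) ⟂ 𝓖^*_{v₀} : Selmer condition of `𝓖` at `v₀`
      rintro _ ⟨x, hx, rfl⟩ y hy
      rw [SetLike.mem_coe, SelmerStructure.mem_selmerGroup_iff] at hx
      exact hy _ (hx v₀)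
    · -- 𝓕_{v₀} ⟂ 𝓖^*_{v₀} ≤ 𝓕^*_{v₀}
      intro a ha y hy
      exact (inv.dualSelmerStructure_anti ρ hle v₀ hy) a ha
  · -- `⊇`: annihilator elements come from Selmer classes (SelmerComplement at the one place)
    intro a ha
    rw [annLeft_sup, AddSubgroup.mem_inf] at ha
    obtain ⟨ha₁, ha₂⟩ := ha
    -- `a ∈ {}^⊥(𝓖^*_{v₀}) = 𝓖_{v₀}`
    have haG : a ∈ 𝓖 v₀ := by
      have h := annLeft_annRight hA hB b hbij.1 hbij.2 (𝓖 v₀)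
      rw [← h]
      rw [dualSelmerStructure_apply, X11b.PoitouTateCounting.dualLocalCondition_eq_annRight] at ha₂
      exact ha₂
    -- the annihilation hypothesis of `SelmerComplement` (i) for `t = single v₀ a`
    obtain ⟨x, hx, hxa, -⟩ :
        ∃ x ∈ 𝓖.selmerGroup, galoisCohomology.localization ρ v₀ 1 x - a ∈ 𝓕 v₀ ∧
          ∀ v ∈ S, v ≠ v₀ → galoisCohomology.localization ρ v 1 x ∈ 𝓕 v := by
      set t : Π v : Place K, galoisCohomology (ρ.toLocal v) 1 := Pi.single v₀ a with ht_def
      have ht : ∀ v ∈ S, t v ∈ 𝓖 v := fun v _ => by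
        by_cases hv : v = v₀
        · subst hv; rw [ht_def, Pi.single_eq_same]; exact haG
        · rw [ht_def, Pi.single_eq_of_ne hv]; exact zero_mem _
      have hann : ∀ y ∈ (inv.dualSelmerStructure ρ 𝓕).selmerGroup,
          ∑ v ∈ S, localTatePairingZMod ρ n v (inv v) (t v)
            (galoisCohomology.localization (ρ.tateDual n) v 1 y) = 0 := fun y hy => by
        have hsum : ∑ v ∈ S, localTatePairingZMod ρ n v (inv v) (t v)
            (galoisCohomology.localization (ρ.tateDual n) v 1 y) =
            localTatePairingZMod ρ n v₀ (inv v₀) (t v₀)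
              (galoisCohomology.localization (ρ.tateDual n) v₀ 1 y) :=
          Finset.sum_eq_single_of_mem v₀ hw₀ fun v _ hv => by
            rw [ht_def, Pi.single_eq_of_ne hv, map_zero, AddMonoidHom.zero_apply]
        rw [hsum, ht_def, Pi.single_eq_same]
        exact ha₁ _ ⟨y, hy, rfl⟩
      obtain ⟨x, hx, hxt⟩ := (hcomp ρ hM S hS 𝓕 𝓖 hle h𝓕 h𝓖).1 t ht hann
      refine ⟨x, hx, ?_, fun v hv hne => ?_⟩
      · have := hxt v₀ hw₀
        rwa [ht_def, Pi.single_eq_same] at this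
      · have := hxt v hv
        rwa [ht_def, Pi.single_eq_of_ne hne, sub_zero] at this
    -- `a = loc x - (loc x - a)`
    have : a = galoisCohomology.localization ρ v₀ 1 x - (galoisCohomology.localization ρ v₀ 1 x - a) := by
      abel
    rw [this]
    exact AddSubgroup.sub_mem _ (AddSubgroup.mem_sup_left ⟨x, hx, rfl⟩) (AddSubgroup.mem_sup_right hxa)

/-- **The counting form of Poitou–Tate duality for Selmer structures at one ARBITRARY place**:
`[H¹_𝓖(K, M) : H¹_𝓕(K, M)] · [H¹_{𝓕^*}(K, M^D) : H¹_{𝓖^*}(K, M^D)] = [𝓖_{v₀} : 𝓕_{v₀}]` for Selmer structures `𝓕 ≤ 𝓖`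
(unramified outside `S`) differing only at `v₀ ∈ S` — X11b's `relIndex_selmerGroup_mul_relIndex_dual_eq` with the local
finiteness and perfectness at `v₀` as HYPOTHESES, so that `v₀` may be a REAL place. Proof verbatim from X11b.
[cite: JetchevSkinnerWan2017, Prop. 3.2.1 proof (arXiv:1512.06894 p. 10)] [cite: Howard2004HeegnerKolyvagin, Thm. 2.1.11 (arXiv:1202.6340 p. 6)] -/
theorem relIndex_selmerGroup_mul_relIndex_dual_eq_of_bijective [NeZero n]
    [Finite (galoisCohomology (ρ.toLocal v₀) 1)] [Finite (galoisCohomology ((ρ.tateDual n).toLocal v₀) 1)]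
    (hbij : Bijective (localTatePairingZMod ρ n v₀ (inv v₀)) ∧ Bijective (localTatePairingZMod ρ n v₀ (inv v₀)).flip)
    (hvan : inv.SumLocalTermEqZero) (hcomp : inv.SelmerComplement) (hM : ∀ m : M, n • m = 0)
    (hS : ∀ v : HeightOneSpectrum (𝓞 K), (Sum.inr v : Place K) ∉ S →
      ((n : ℕ) : 𝓞 K) ∉ v.asIdeal ∧ GaloisRep.IsUnramifiedAt v ρ)
    (hle : 𝓕 ≤ 𝓖) (h𝓕 : 𝓕.IsUnramifiedOutside S) (h𝓖 : 𝓖.IsUnramifiedOutside S)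
    (hw₀ : v₀ ∈ S) (heq : ∀ v ≠ v₀, 𝓕 v = 𝓖 v) :
    𝓕.selmerGroup.relIndex 𝓖.selmerGroup *
        (inv.dualSelmerStructure ρ 𝓖).selmerGroup.relIndex
          (inv.dualSelmerStructure ρ 𝓕).selmerGroup =
      (𝓕 v₀).relIndex (𝓖 v₀) := by
  classical
  set b := localTatePairingZMod ρ n v₀ (inv v₀) with hb
  have hA : ∀ a : galoisCohomology (ρ.toLocal v₀) 1, n • a = 0 :=
    galoisCohomology.nsmul_eq_zero_of_forall (ρ.toLocal v₀) hM
  have hB : ∀ y : galoisCohomology ((ρ.tateDual n).toLocal v₀) 1, n • y = 0 :=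
    galoisCohomology.nsmul_eq_zero_of_forall _ fun f => DiscreteGaloisModule.TateDual.nsmul_eq_zero f
  -- the two big subgroups `X ≤ H¹(K_{v₀}, M)`, `Y ≤ H¹(K_{v₀}, M^D)`
  set X := 𝓖.selmerGroup.map (galoisCohomology.localization ρ v₀ 1) ⊔ 𝓕 v₀ with hX
  set Y := (inv.dualSelmerStructure ρ 𝓕).selmerGroup.map
      (galoisCohomology.localization (ρ.tateDual n) v₀ 1) ⊔ inv.dualSelmerStructure ρ 𝓖 v₀ with hY
  have hXY : X = annLeft b Y :=
    sup_map_selmerGroup_eq_annLeft_of_bijective hbij hvan hcomp hM hS hle h𝓕 h𝓖 hw₀ heq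
  -- indices as quotients of cardinalities
  have h1 : 𝓕.selmerGroup.relIndex 𝓖.selmerGroup = (𝓕 v₀).relIndex X :=
    relIndex_selmerGroup_eq hle heq
  have hle' : inv.dualSelmerStructure ρ 𝓖 ≤ inv.dualSelmerStructure ρ 𝓕 :=
    inv.dualSelmerStructure_anti ρ hle
  have heq' : ∀ v ≠ v₀, inv.dualSelmerStructure ρ 𝓖 v = inv.dualSelmerStructure ρ 𝓕 v :=
    fun v hv => by rw [dualSelmerStructure_apply, dualSelmerStructure_apply, heq v hv]
  have h2 : (inv.dualSelmerStructure ρ 𝓖).selmerGroup.relIndex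
      (inv.dualSelmerStructure ρ 𝓕).selmerGroup = (inv.dualSelmerStructure ρ 𝓖 v₀).relIndex Y :=
    relIndex_selmerGroup_eq hle' heq'
  rw [h1, h2]
  -- cardinalities
  have cXY : Nat.card X * Nat.card Y = Nat.card (galoisCohomology (ρ.toLocal v₀) 1) :=
    natCard_mul_natCard_eq_of_eq_annLeft hB b hbij.1 hXY
  have cF : Nat.card (𝓕 v₀) * (𝓕 v₀).relIndex X = Nat.card X :=
    natCard_mul_relIndex_of_le le_sup_right
  have cG' : Nat.card (inv.dualSelmerStructure ρ 𝓖 v₀) *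
      (inv.dualSelmerStructure ρ 𝓖 v₀).relIndex Y = Nat.card Y :=
    natCard_mul_relIndex_of_le le_sup_right
  have cFG : Nat.card (𝓕 v₀) * (𝓕 v₀).relIndex (𝓖 v₀) = Nat.card (𝓖 v₀) :=
    natCard_mul_relIndex_of_le (hle v₀)
  have cGdual : Nat.card (inv.dualSelmerStructure ρ 𝓖 v₀) * Nat.card (𝓖 v₀) =
      Nat.card (galoisCohomology ((ρ.tateDual n).toLocal v₀) 1) := by
    rw [dualSelmerStructure_apply, X11b.PoitouTateCounting.dualLocalCondition_eq_annRight]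
    exact natCard_annRight_mul hA b hbij.2 (𝓖 v₀)
  have cAB : Nat.card (galoisCohomology (ρ.toLocal v₀) 1) =
      Nat.card (galoisCohomology ((ρ.tateDual n).toLocal v₀) 1) :=
    natCard_eq_of_bijective hB b hbij.1
  have hposF : 0 < Nat.card (𝓕 v₀) := Nat.card_pos
  have hposG' : 0 < Nat.card (inv.dualSelmerStructure ρ 𝓖 v₀) := Nat.card_pos
  refine Nat.eq_of_mul_eq_mul_left (Nat.mul_pos hposF hposG') ?_
  calc Nat.card (𝓕 v₀) * Nat.card (inv.dualSelmerStructure ρ 𝓖 v₀) *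
        ((𝓕 v₀).relIndex X * (inv.dualSelmerStructure ρ 𝓖 v₀).relIndex Y)
      = (Nat.card (𝓕 v₀) * (𝓕 v₀).relIndex X) *
          (Nat.card (inv.dualSelmerStructure ρ 𝓖 v₀) *
            (inv.dualSelmerStructure ρ 𝓖 v₀).relIndex Y) := by ring
    _ = Nat.card X * Nat.card Y := by rw [cF, cG']
    _ = Nat.card (galoisCohomology ((ρ.tateDual n).toLocal v₀) 1) := by rw [cXY, cAB]
    _ = Nat.card (inv.dualSelmerStructure ρ 𝓖 v₀) * Nat.card (𝓖 v₀) := cGdual.symm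
    _ = Nat.card (inv.dualSelmerStructure ρ 𝓖 v₀) * (Nat.card (𝓕 v₀) * (𝓕 v₀).relIndex (𝓖 v₀)) := by
          rw [cFG]
    _ = Nat.card (𝓕 v₀) * Nat.card (inv.dualSelmerStructure ρ 𝓖 v₀) *
          (𝓕 v₀).relIndex (𝓖 v₀) := by ring

end AnyPlace

/-! ## §42 `E[n]` at an INFINITE place: both adjoints of `⟨·,·⟩_w` on `H¹(K_w, E[n]) × H¹(K_w, E[n]^D)` are bijective -/

-- Cup products need `LocallyCompactSpace Γ`; the compactness of absolute Galois groups is a local instance, as are the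
-- finiteness of `E[n]` and of `μₙ` (as in X5 `SelfDualCount`).
attribute [local instance] absoluteGaloisGroup_compactSpace
attribute [local instance] finite_geomTorsion_of_neZero Literature.NumberTheory.EllipticCurves.finite_muCarrier

section RealPlace

variable {K : Type} [Field K] [NumberField K] (W : WeierstrassCurve K) (n : ℕ) [NeZero n] [W.IsElliptic]
variable (e : geomTorsion W n → geomTorsion W n → AlgebraicClosure K)
  (hμ : ∀ S T, e S T ^ n = 1)
  (hadd₁ : ∀ S₁ S₂ T, e (S₁ + S₂) T = e S₁ T * e S₂ T)
  (hadd₂ : ∀ S T₁ T₂, e S (T₁ + T₂) = e S T₁ * e S T₂)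
  (hgal : ∀ (σ : absoluteGaloisGroup K) (S T : geomTorsion W n), σ • e S T = e (σ • S) (σ • T))
  (halt : ∀ T, e T T = 1)
  (hnondeg : ∀ T, (∀ S, e S T = 1) → T = 0)
  (inv : LocalInvariants K n)

/-- `H¹(K_w, E[n])` is finite at an infinite place (`Γ_{K_w}` has order `≤ 2`). [cite: MilneADT2006, Ch. I, Thm. 2.13] -/
theorem finite_galoisCohomology_one_torsion_inl (w : InfinitePlace K) :
    Finite (galoisCohomology ((W.torsionGaloisModule (n : ℤ)).toLocal (Sum.inl w)) 1) := by
  haveI : Finite (absoluteGaloisGroup (Place.Completion (Sum.inl w : Place K))) :=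
    finite_absoluteGaloisGroup_completion_infinitePlace w
  exact finite_galoisCohomology_one_of_finite_absoluteGaloisGroup _

/-- `H¹(K_w, E[n]^D)` is finite at an infinite place. [cite: MilneADT2006, Ch. I, Thm. 2.13] -/
theorem finite_galoisCohomology_one_tateDual_torsion_inl (w : InfinitePlace K) :
    Finite (galoisCohomology (((W.torsionGaloisModule (n : ℤ)).tateDual n).toLocal (Sum.inl w)) 1) := by
  haveI : Finite (absoluteGaloisGroup (Place.Completion (Sum.inl w : Place K))) :=
    finite_absoluteGaloisGroup_completion_infinitePlace w
  haveI := DiscreteGaloisModule.TateDual.finite K (geomTorsion W n) n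
  exact finite_galoisCohomology_one_of_finite_absoluteGaloisGroup _

include hμ hadd₁ hadd₂ hgal halt hnondeg in
/-- **Archimedean Tate duality for `E[n]` in the `M^D`-currency of the Poitou–Tate family.** At an infinite place `w` with `inv_w`
injective on `H²(K_w, μₙ)` (the real-place clause of `poitouTate_selmerStructure_duality_real`; `Br(ℝ) = ½ℤ/ℤ`), both adjoints of
`⟨x, y⟩_w = inv_w(x ∪ y)` on `H¹(K_w, E[n]) × H¹(K_w, E[n]^D)` are bijective: the Weil transport `H¹(w_w) : H¹(K_w, E[n]) → H¹(K_w, E[n]^D)`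
is bijective (`map_weilDual_map_weilDualInv_restrictField` / `map_weilDualInv_map_weilDual_restrictField`) and carries `⟨·,·⟩_w` to the
Weil self-pairing `inv_w(· ∪ₑ ·)` (`X11b.LocBridge.localTatePairingZMod_map_weilDual`), whose adjoints are bijective by the tree's
archimedean duality `bijective_weilCupProduct_infinitePlace` (Milne I Thm. 2.13 (a)). [cite: MilneADT2006, Ch. I, Thm. 2.13 (a)] -/
theorem bijective_localTatePairingZMod_inl (w : InfinitePlace K) (hι : Injective (inv (Sum.inl w))) :
    Bijective (localTatePairingZMod (W.torsionGaloisModule (n : ℤ)) n (Sum.inl w) (inv (Sum.inl w))) ∧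
      Bijective (localTatePairingZMod (W.torsionGaloisModule (n : ℤ)) n (Sum.inl w) (inv (Sum.inl w))).flip := by
  set v : Place K := Sum.inl w with hv
  set b := localTatePairingZMod (W.torsionGaloisModule (n : ℤ)) n v (inv v) with hb
  set p := X11b.Relaxation.invWeilPairing W n e hμ hadd₁ hadd₂ hgal inv v with hp_def
  set θ : galoisCohomology ((W.torsionGaloisModule (n : ℤ)).toLocal v) 1 →+
      galoisCohomology (((W.torsionGaloisModule (n : ℤ)).tateDual n).toLocal v) 1 :=
    galoisCohomology.map ((weilDualIntertwining W n e hμ hadd₁ hadd₂ hgal).restrictField (Place.Completion v)) 1 with hθ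
  set θ' : galoisCohomology (((W.torsionGaloisModule (n : ℤ)).tateDual n).toLocal v) 1 →+
      galoisCohomology ((W.torsionGaloisModule (n : ℤ)).toLocal v) 1 :=
    galoisCohomology.map ((weilDualInv W n e hμ hadd₁ hadd₂ hgal hnondeg).restrictField (Place.Completion v)) 1 with hθ'
  have hθθ' : ∀ y, θ (θ' y) = y := fun y ↦
    map_weilDual_map_weilDualInv_restrictField W n e hμ hadd₁ hadd₂ hgal hnondeg (Place.Completion v) y
  have hθ'θ : ∀ x, θ' (θ x) = x := fun x ↦
    map_weilDualInv_map_weilDual_restrictField W n e hμ hadd₁ hadd₂ hgal hnondeg (Place.Completion v) x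
  -- the Weil self-pairing has bijective adjoints (archimedean Tate duality, tree)
  have hp : Bijective p ∧ Bijective p.flip :=
    bijective_weilCupProduct_infinitePlace W n e hμ hadd₁ hadd₂ w hgal halt hnondeg (inv (Sum.inl w)) hι p
      (fun x y ↦ X11b.Relaxation.invWeilPairing_apply W n e hμ hadd₁ hadd₂ hgal inv v x y)
  -- `b a (θ x) = p a x`
  have hbθ : ∀ a x, b a (θ x) = p a x := fun a x ↦ by
    have h1 := localTatePairingZMod_map_weilDual W n e hμ hadd₁ hadd₂ hgal v (inv v) a x
    rw [hp_def, X11b.Relaxation.invWeilPairing_apply]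
    exact h1
  -- `b a y = p a (θ' y)`
  have hbp : ∀ a y, b a y = p a (θ' y) := fun a y ↦ by
    have h := hbθ a (θ' y)
    rwa [hθθ'] at h
  have hθ'inj : Injective θ' := Function.LeftInverse.injective hθθ'
  refine ⟨⟨fun a a' h ↦ hp.1.1 (AddMonoidHom.ext fun x ↦ ?_), fun f ↦ ?_⟩,
    ⟨fun y y' h ↦ ?_, fun g ↦ ?_⟩⟩
  · -- injective
    calc p a x = b a (θ x) := (hbθ a x).symm
      _ = b a' (θ x) := by rw [h]
      _ = p a' x := hbθ a' x
  · -- surjective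
    obtain ⟨a, ha⟩ := hp.1.2 (f.comp θ)
    refine ⟨a, AddMonoidHom.ext fun y ↦ ?_⟩
    calc b a y = p a (θ' y) := hbp a y
      _ = (f.comp θ) (θ' y) := by rw [ha]
      _ = f y := by rw [AddMonoidHom.comp_apply, hθθ']
  · -- flip injective
    refine hθ'inj (hp.2.1 (AddMonoidHom.ext fun a ↦ ?_))
    have hh := DFunLike.congr_fun h a
    rw [AddMonoidHom.flip_apply, AddMonoidHom.flip_apply] at hh
    calc p.flip (θ' y) a = p a (θ' y) := rfl
      _ = b a y := (hbp a y).symm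
      _ = b a y' := hh
      _ = p a (θ' y') := hbp a y'
      _ = p.flip (θ' y') a := rfl
  · -- flip surjective
    obtain ⟨x, hx⟩ := hp.2.2 g
    refine ⟨θ x, AddMonoidHom.ext fun a ↦ ?_⟩
    calc b.flip (θ x) a = b a (θ x) := rfl
      _ = p a x := hbθ a x
      _ = p.flip x a := rfl
      _ = g a := by rw [hx]

end RealPlace

end Summit.BirchSwinnertonDyer.BirchSwinnertonDyer.Theorems.GenusKolyArch

end
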